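import Summits.AtomisticToContinuum.HydrodynamicLimit.Theorems.TwoClocksClampedWindowDockTimeZero
import Literature.MathematicalPhysics.KineticTheory.LambertianHardSphereFlow
import Literature.Analysis.FluidPDE.HardSphereAlexander
import HarnessLib

/-!
# `SwapGap` (stmt-AtomisticToContinuum-11850): the `t = 0` instance of stub S1 (`RelEntSwap`) of line `Sketch`

Sanity instance for the line's lead stub S1 (`RelEntSwap`:
`KL((Φ_t)_* P_N ‖ (Λ_t)_* (P_N ⊗ γ^ℕ))/(N+1) → 0` pre-shock): at `t = 0` both laws ARE the local
Gibbs law — the deterministic flow is the identity on its good set (`lawAt_zero_localGibbsLaw`) and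
the Lambertian flow of the route is the identity on Alexander's good set `Γ₀` (positive exit time,
`lambertFlow_zero_of_pos`), which is Liouville-conull (`torusFlow_ae_good_holds`) and hence carries
`P_N` — so the relative entropy is `0` for every `N`:

* `ae_lambertFlow_zero_eq` — `Λ_0(z, ξ) = z` for `P ⊗ γ^ℕ`-a.e. `(z, ξ)`, for every `P ≪ Liouville`
  (`0 < ε < 1/2` on `𝕋³`);
* `map_lambertFlow_zero_prod` — `(Λ_0)_* (P ⊗ γ^ℕ) = P` for such probability laws `P`;
* `klDiv_map_flow_zero_map_lambertFlow_zero` — `KL((Φ_0)_* P_N ‖ (Λ_0)_* (P_N ⊗ γ^ℕ)) = 0`.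

prover-line-stmt-AtomisticToContinuum-11850-0, cycle 1.
-/

noncomputable section

open MeasureTheory Filter Set Topology InformationTheory
open scoped ENNReal

namespace Summit.AtomisticToContinuum.HydrodynamicLimit.Theorems

open Literature.Analysis.FluidPDE Literature.MathematicalPhysics.KineticTheory

/-- **The Lambertian flow starts at the datum, almost surely.** For `0 < ε < 1/2` on `𝕋³` and a law
`P ≪ Liouville`, `Λ_0(z, ξ) = z` for `P ⊗ γ^ℕ`-almost every `(z, ξ)`: Alexander's good set is
Liouville-conull (`torusFlow_ae_good_holds`), its points have positive exit time, and then
`lambertFlow_zero_of_pos`. [folklore] -/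
theorem ae_lambertFlow_zero_eq {N : ℕ} {ε : ℝ} (hε : 0 < ε) (hε' : ε < 2⁻¹)
    (P : Measure (Config N (Fin 3) T3)) [SFinite P]
    (hP : P ≪ liouville (Torus.geometry (Fin 3)) N ε) :
    ∀ᵐ p ∂(P.prod (lambertNoise (Fin 3))),
      lambertFlow (Torus.geometry (Fin 3)) ε p.2 p.1 0 = p.1 := by
  have hgood : ∀ᵐ z ∂P, z ∈ Alexander.good (Torus.geometry (Fin 3)) ε :=
    hP (Alexander.torusFlow_ae_good_holds hε hε' N)
  have hG := Torus.isHardSphereRegular_geometry (d := Fin 3) hε'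
  have h1 : ∀ᵐ p ∂(P.prod (lambertNoise (Fin 3))), p.1 ∈ Alexander.good (Torus.geometry (Fin 3)) ε := by
    have hnull : P {z | z ∉ Alexander.good (Torus.geometry (Fin 3)) ε} = 0 := ae_iff.1 hgood
    rw [ae_iff]
    have hsub : {p : Config N (Fin 3) T3 × (ℕ → EuclideanSpace ℝ (Fin 3)) |
        ¬p.1 ∈ Alexander.good (Torus.geometry (Fin 3)) ε} ⊆
        {z | z ∉ Alexander.good (Torus.geometry (Fin 3)) ε} ×ˢ
          (univ : Set (ℕ → EuclideanSpace ℝ (Fin 3))) := by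
      intro p hp
      exact ⟨hp, mem_univ _⟩
    refine measure_mono_null hsub ?_
    rw [Measure.prod_prod, hnull, zero_mul]
  filter_upwards [h1] with p hp
  exact lambertFlow_zero_of_pos (Alexander.freeExitTime_pos_of_mem_good hG hp)

/-- **At time `0` the image of `P ⊗ γ^ℕ` under the Lambertian flow is `P`** (probability law
`P ≪ Liouville`, `0 < ε < 1/2`). [folklore] -/
theorem map_lambertFlow_zero_prod {N : ℕ} {ε : ℝ} (hε : 0 < ε) (hε' : ε < 2⁻¹)
    (P : Measure (Config N (Fin 3) T3)) [IsProbabilityMeasure P]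
    (hP : P ≪ liouville (Torus.geometry (Fin 3)) N ε) :
    (P.prod (lambertNoise (Fin 3))).map
        (fun p => lambertFlow (Torus.geometry (Fin 3)) ε p.2 p.1 0) = P := by
  have hae : (fun p : Config N (Fin 3) T3 × (ℕ → EuclideanSpace ℝ (Fin 3)) =>
      lambertFlow (Torus.geometry (Fin 3)) ε p.2 p.1 0) =ᵐ[P.prod (lambertNoise (Fin 3))] Prod.fst :=
    ae_lambertFlow_zero_eq hε hε' P hP
  rw [Measure.map_congr hae, Measure.map_fst_prod, measure_univ, one_smul]

/-- **The `t = 0` instance of `RelEntSwap` (stub S1 of line `Sketch`)**: for `0 < σ < 1/2`,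
continuous positive profiles, every `N` and every flow,
`KL((Φ_0)_* P_N ‖ (Λ_0)_* (P_N ⊗ γ^ℕ)) = 0` — both image laws are the local Gibbs law `P_N` itself.
[folklore] -/
theorem klDiv_map_flow_zero_map_lambertFlow_zero {σ : ℝ} (hσ : 0 < σ) (hσ' : σ < 2⁻¹)
    {a₀ θ₀ : T3 → ℝ} {u₀ : T3 → V3} (ha : Continuous a₀) (hθ : Continuous θ₀) (hu : Continuous u₀)
    (ha0 : ∀ x, 0 < a₀ x) (hθ0 : ∀ x, 0 < θ₀ x) (N : ℕ)
    (Φ : HardSphereFlow (Torus.geometry (Fin 3)) (hsDiameter σ N) (N + 1)) :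
    klDiv ((localGibbsLaw σ a₀ u₀ θ₀ N Φ).map (Φ.flow 0))
        (((localGibbsLaw σ a₀ u₀ θ₀ N Φ).prod (lambertNoise (Fin 3))).map
          (fun p => lambertFlow (Torus.geometry (Fin 3)) (hsDiameter σ N) p.2 p.1 0)) = 0 := by
  haveI := isProbabilityMeasure_localGibbsLaw ha hθ hu ha0 hθ0 (by linarith) N Φ
  have hP : localGibbsLaw σ a₀ u₀ θ₀ N Φ ≪
      liouville (Torus.geometry (Fin 3)) (N + 1) (hsDiameter σ N) := by
    rw [localGibbsLaw, particleLaw_eq]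
    exact withDensity_absolutelyContinuous _ _
  have hε : 0 < hsDiameter σ N := hsDiameter_pos hσ N
  have hε' : hsDiameter σ N < 2⁻¹ := (hsDiameter_le hσ.le N).trans_lt hσ'
  rw [map_lambertFlow_zero_prod hε hε' _ hP, ← HardSphereFlow.lawAt_eq,
    EntropyClockDock.lawAt_zero_localGibbsLaw]
  exact klDiv_self _

end Summit.AtomisticToContinuum.HydrodynamicLimit.Theorems
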